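import Summits.QuantumFields.BalabanUV.Beta.D1BFx.PackedStraightColumnMass
import Summits.QuantumFields.BalabanUV.Beta.D1BFx.RawPairStencilSupportRows

/-!
# `BalabanUV.Beta.D1BFx.PackedStraightColumnWilsonPair` — road «BF-x» for binder row D1, slot (K), PART 24 letter «M-pack» AT THE CHART OF RECORD (α′), FILE C of «K0-PACK»:
# **THE LOCAL-TABLE BLOCK-PAIR COUNT (POWER `n^D`, NOT THE `n^{2D}` OF BLOCK-SCALE RATES) AND THE PURE-WILSON STRAIGHT-PIN PAIR LETTER OF R-T WITH POWER 2,
# HYPOTHESIS-FREE** — the unit page's «packed pair tt vertex `≍ n²·m̄W`» as a theorem for the Wilson sector; the border sector stays a displayed letter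

HONEST DEPENDENCY (cell records, verbatim): «continuum YM on T⁴ ⇐ BetaPertH ∧ nine spine estimates (0/9 proved); BetaPertH ⇐ (D1) ∧ (D4) ∧
CAP+tail; G-an2-4 gates asym, D1 and NE2/3/4.»  HONEST FRAMING (cell contract, verbatim): «discharging `BetaPertH` makes Bałaban's UV stability
UNCONDITIONAL — a real constructive-QFT result; it is NOT the continuum limit and NOT the Clay problem.»  THIS MODULE DISCHARGES NOTHING of the
wall: [folklore] `ℓ¹` ∕ lattice counting BY NAME over LANDED objects («K0-PACK» FILE B `PackedStraightColumnMass` §5, d1-leaf-01's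
`RawPairStencilSupportRows.plainMass_blk_wilsonW₂_le` over an3's `WilsonBiStencil.wilsonW₂ ∕ wBound₂ ∕ biLoc_wilsonW₂`).  No definition, no `def … : Prop`,
nothing cited, 0 sorry.  Nothing of an3's table or of Bałaban's is asserted (`wBound₂ 3 T` stays symbolic; the other sector's count is a DISPLAYED hypothesis);
NO (1.22) row is proved (R-T's row is the OWNER's, modulo `h12 ∧ h126`); 0 root-level binders of row D1 discharged (hW ∕ hR-sockets ∕ hSX-socket ∕ D1Tel ∕ D1Rep = 0);
(J1) ONE OPEN ROW; (K) NOT closed; NOT D1, NEVER «G-an2-4 closed», NOT `BetaPertH`, NOT continuum, NOT Clay.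

ABSOLUTE RULE (cell charter, verbatim): «No internally-minted statement may enter as a cited fact. Every hypothesis is either kernel-proved in
this package or a verbatim quotation of a PUBLISHED theorem with page reference. The manuscript(s) under audit are NOT citable for their own
disputed steps — they are the thing under adjudication; programme-internal (2001/route/tribunal) claims are never citable.»

WHY.  R-T `RestKernelSandwichScaled.exists_row_RkSand_tadpole_unit` (OWNER d1-p2 g23, p351880 ✓) closes PART 24's tadpole member (T) from a pair letter WITH POWER 2,
`hWm : Σ' |ffW (𝒲 (m+1)) μ 0 ν z| ≤ ((m+1):ℝ)^2·mW·e^{−κ|z|₁}` (UNIT-PAGE-g23 §1: «`W_tt = Σ h h′ w₄` … `≤ n²·m̄W·e^{−κ|z|₁}`»).  FILE B §5 delivers power `p` from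
block-pair totals `≤ n^{p+10}·m̄W` (two straight columns pay `n⁻¹⁰` exactly).  The Wilson pair table is LOCAL with an n-FREE rate (d1-leaf-01
`plainMass_blk_wilsonW₂_le`: `Σ'|blk (wilsonW₂ 3 T κ u κ′ u′) j i| ≤ 16·(wBound₂ 3 T·e⁸·e^{−1·|u′ − u|₁})·Zl 4 (1∕2)²`), so its honest block-pair count is `n⁴`
(§1–§2: in-block offsets are `< n` per coordinate while distinct blocks are `≥ n` apart, so `|u′ − u|₁ ≥ |y₂ − y₁|₁` with NO `e^{θDn}` offset cost), NOT the `n⁸`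
of FILE 5 `PackedColumnBlockTotalOfPerSlot.hTB_of_hBm` (built for block-scale rates `θ∕n`; `hBm_wilsonW₂` WEAKENS the rate to `δ₂₀∕n` to fit it).  With the literal's
`n⁸` in front (`S₂⁰`'s Wilson sector `n⁸ • wilsonW₂ 3 ((8N²)⁻¹ • wsym22 N)`, d1-leaf-03's TT8) the count is `n^{12}·m̄W` ⟹ `p = 2` (§3), HYPOTHESIS-FREE; the border
sector `cB • tabs.vh₂S` enters §3's two-sector form as a DISPLAYED block-pair letter (an1's count, not supplied).

CONTENT.
* §1 [folklore, generic `D`, block side `n ≥ 1`]: **`abs_le_abs_nsmul_add`** (`|Δ| ≤ |nΔ + β|` for `|β| ≤ n − 1`), **`l1_blockPair_ge`**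
  (`|y₂ − y₁|₁ ≤ |(n•y₂ + b′) − (n•y₁ + b)|₁` for box points `b, b′`), **`blockPairTotal_le_of_local`** (per-slot-pair `m u u′ ≤ mB·e^{−θ₀|u′ − u|₁}`, `θ₀ > 0` n-free ⟹
  `Σ_{b,b′ ∈ box D n} m (n•y₁+b) (n•y₂+b′) ≤ n^D·(Zl D (θ₀∕2)·mB)·e^{−(θ₀∕2)|y₂ − y₁|₁}`).
* §2 [d = 3, BY NAME over d1-leaf-01 ∕ an3]: **`blockPairTotal_smul_wilsonW₂_le`** (`Σ_{b,b′} Σ'|blk (c • wilsonW₂ 3 T κ (n•y₁+b) κ′ (n•y₂+b′)) j i| ≤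
  n⁴·(|c|·C_W(T))·e^{−(1∕2)|y₂ − y₁|₁}`, `C_W(T) := Zl 4 (1∕2)·(16·(wBound₂ 3 T·e⁸)·Zl 4 (1∕2)²)`), after `blk_smul_apply` (rfl) and
  **`plainMass_blk_smul_wilsonW₂_le`** (per slot pair: summable ∧ `≤ (|c|·16·(wBound₂ 3 T·e⁸)·Zl 4 (1∕2)²)·e^{−1·|u′ − u|₁}`).
* §3 THE LETTER: **`ffW_vertex2OfK_K₀_wilson_rows`** (and `_unit`, `c₀ = 1`) — for `𝒲 n := vertex2OfK (KInvStep 3 n 0) n (((n:ℝ)^8·c₀) • wilsonW₂ 3 T)`, every `m`, `z`: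
  `Summable` ∧ `Σ'|ffW (𝒲 (m+1)) μ 0 ν z| ≤ ((m+1):ℝ)^2·(C_{K₀,2}(1∕2)·(|c₀|·C_W(T)))·e^{−(min (κ′∕8) (1∕4))·|z|₁}` — HYPOTHESIS-FREE, POWER 2;
  **`ffW_vertex2OfK_K₀_wilson_add_rows`** — the two-sector family `((n:ℝ)^8·c₀) • wilsonW₂ 3 T + V₂ n` with the other sector's tt per-slot-pair summability and
  block-pair totals `≤ n^{12}·m̄V·e^{−(1∕2)|y₂ − y₁|₁}` DISPLAYED ⟹ the same with `|c₀|·C_W(T) + m̄V`.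
NOT HERE (honest): any letter of `vh₂S` (an1's); the `mixOfK` ∕ `K2OfK` parts of `W^{smooth}`; any (1.22) row; the cross-word cancellation (OWNER A-2 to F-g23-2 R10:
≈ 99 % at `n = 3` — these are per-word absolute letters).
Unit `b2b-balaban-gan24-formalise-leaf-05` (gen 60), G-an2-4 swarm leaf prover 05, road «BF-x» supplier; INTENT-2 «K0-WILSON-PAIR» (journal [GAN24LEAF05-G60-INTENT-2]).
-/

noncomputable section

open Finset
open scoped BigOperators
open Literature.MathematicalPhysics.QuantumFieldTheory
open Literature.MathematicalPhysics.QuantumFieldTheory.Balaban1983to89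
open Literature.MathematicalPhysics.QuantumFieldTheory.Balaban1983to89.Beta
open B12Sec2to5 (l1 l1_nonneg)
open B5Hk163Strip (kappa163 kappa163_pos)
open B5Hk163Decay (MG163)
open B4TorusKernel (periodConst)
open ExpKernelCalculus (Site MKer Zl Zl_pos Zl_nonneg tsum_exp_shift' summable_exp_shift')
open AffineAveraging (box toSite)
open OneStepResolventKernel (Fib wsum)
open OneStepKernelFamily (colH KInvStep)
open SecondOrderResponse (vertex2OfK)
open WilsonBiStencil (wilsonW₂ wBound₂ wBound₂_nonneg)
open Summit.QuantumFields.BalabanUV.Beta.D1BFx.PackedKernelSplit (blk ffW)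
open Summit.QuantumFields.BalabanUV.Beta.D1BFx.RawPairStencilSupportRows (plainMass_blk_wilsonW₂_le)
open Summit.QuantumFields.BalabanUV.Beta.D1BFx.PackedStraightColumnMass (ffW_vertex2OfK_K₀_rows_pow)

namespace Summit.QuantumFields.BalabanUV.Beta.D1BFx.PackedStraightColumnWilsonPair

/-! ## §1 Generic: the block-pair count of a LOCAL pair table (n-free rate) is `n^D`, with the coarse decay for free -/

section Local

variable {D : ℕ}

/-- [folklore] **DISTINCT BLOCKS ARE FURTHER APART THAN IN-BLOCK OFFSETS**, one coordinate: for an integer `Δ` and an offset `|β| ≤ n − 1`, `|Δ| ≤ |n·Δ + β|`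
(`Δ = 0` trivially; else `|nΔ + β| ≥ n|Δ| − (n − 1) ≥ |Δ|`). -/
theorem abs_le_abs_nsmul_add (n : ℕ) (Δ β : ℤ) (hβ : |β| ≤ (n : ℤ) - 1) : |Δ| ≤ |(n : ℤ) * Δ + β| := by
  rcases eq_or_ne Δ 0 with h | h
  · rw [h, abs_zero]; exact abs_nonneg _
  · have h1 : 1 ≤ |Δ| := Int.one_le_abs h
    have hβ0 : 0 ≤ |β| := abs_nonneg β
    have hn1 : (1 : ℤ) ≤ n := by linarith
    have h2 : |(n : ℤ) * Δ| ≤ |(n : ℤ) * Δ + β| + |β| := by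
      have := abs_sub ((n : ℤ) * Δ + β) β
      simpa using this
    rw [abs_mul, Nat.abs_cast] at h2
    nlinarith

/-- [folklore] **`|y₂ − y₁|₁ ≤ |(n•y₂ + b′) − (n•y₁ + b)|₁`** for box points `b, b′ ∈ box D n`: the `ℓ¹` distance between slots of two blocks is at least the `ℓ¹` distance
of the block LABELS — coordinatewise the previous lemma (`|b′ᵢ − bᵢ| ≤ n − 1`); NO `e^{θDn}` offset cost, unlike FILE 2's `exp_block_offset_le`. -/
theorem l1_blockPair_ge {n : ℕ} (y₁ y₂ : Fin D → ℤ) {b b' : Fin D → ℕ} (hb : b ∈ box D n) (hb' : b' ∈ box D n) :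
    l1 (y₂ - y₁) ≤ l1 (((n : ℤ) • y₂ + toSite b') - ((n : ℤ) • y₁ + toSite b)) := by
  unfold B12Sec2to5.l1
  refine Finset.sum_le_sum fun i _ => ?_
  have hbi : b i < n := by
    have h' := hb; simp only [AffineAveraging.box, Fintype.mem_piFinset, Finset.mem_range] at h'; exact h' i
  have hb'i : b' i < n := by
    have h' := hb'; simp only [AffineAveraging.box, Fintype.mem_piFinset, Finset.mem_range] at h'; exact h' i
  have e : (((n : ℤ) • y₂ + toSite b') - ((n : ℤ) • y₁ + toSite b)) i = (n : ℤ) * (y₂ - y₁) i + (((b' i : ℕ) : ℤ) - ((b i : ℕ) : ℤ)) := by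
    simp only [Pi.sub_apply, Pi.add_apply, Pi.smul_apply, smul_eq_mul, AffineAveraging.toSite]; ring
  have hβ : |(((b' i : ℕ) : ℤ) - ((b i : ℕ) : ℤ))| ≤ (n : ℤ) - 1 := by
    rw [abs_le]; constructor <;> omega
  have h := abs_le_abs_nsmul_add n ((y₂ - y₁) i) _ hβ
  rw [← e] at h
  exact_mod_cast h

/-- [folklore] **THE BLOCK-PAIR COUNT OF A LOCAL PAIR TABLE IS `n^D`**: if `0 ≤ m u u′ ≤ mB·e^{−θ₀|u′ − u|₁}` with an n-FREE rate `θ₀ > 0`, then for all coarse blocks `y₁, y₂`,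
`Σ_{b ∈ box D n} Σ_{b′ ∈ box D n} m (n•y₁ + b) (n•y₂ + b′) ≤ n^D·(Zl D (θ₀∕2)·mB)·e^{−(θ₀∕2)|y₂ − y₁|₁}` — half the rate pays the inner lattice sum (`Σ_{b′} ≤ Σ'_w = Zl D (θ₀∕2)`,
`tsum_exp_shift'`), half the block decay (`l1_blockPair_ge`); the outer sum has `(box D n).card = n^D` terms.  Compare FILE 5's `hTB_of_hBm`: rate `θ∕n` ⟹ `n^{2D}`. -/
theorem blockPairTotal_le_of_local {n : ℕ} {m : (Fin D → ℤ) → (Fin D → ℤ) → ℝ} {mB θ₀ : ℝ} (hθ₀ : 0 < θ₀)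
    (hm0 : ∀ u u', 0 ≤ m u u') (hmB : ∀ u u', m u u' ≤ mB * Real.exp (-θ₀ * l1 (u' - u))) (y₁ y₂ : Fin D → ℤ) :
    ∑ b ∈ box D n, ∑ b' ∈ box D n, m ((n : ℤ) • y₁ + toSite b) ((n : ℤ) • y₂ + toSite b')
      ≤ (n : ℝ) ^ D * (Zl D (θ₀ / 2) * mB) * Real.exp (-(θ₀ / 2) * l1 (y₂ - y₁)) := by
  have hmB0 : 0 ≤ mB := by
    have h := (hm0 0 0).trans (hmB 0 0)
    simpa [B12Sec2to5.l1] using h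
  have hθ2 : 0 < θ₀ / 2 := by positivity
  set E : ℝ := Real.exp (-(θ₀ / 2) * l1 (y₂ - y₁)) with hE
  -- per pair: split the rate
  have hpt : ∀ b ∈ box D n, ∀ b' ∈ box D n,
      m ((n : ℤ) • y₁ + toSite b) ((n : ℤ) • y₂ + toSite b')
        ≤ (mB * E) * Real.exp (-(θ₀ / 2) * l1 (((n : ℤ) • y₂ + toSite b') - ((n : ℤ) • y₁ + toSite b))) := by
    intro b hb b' hb'
    refine (hmB _ _).trans ?_
    have hl := l1_blockPair_ge (n := n) y₁ y₂ hb hb'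
    have hl0 := l1_nonneg (((n : ℤ) • y₂ + toSite b') - ((n : ℤ) • y₁ + toSite b))
    rw [hE, mul_assoc, ← Real.exp_add]
    refine mul_le_mul_of_nonneg_left (Real.exp_le_exp.2 ?_) hmB0
    nlinarith
  -- inner sum over `b′`: a finite piece of the shifted lattice sum `Zl D (θ₀∕2)`
  have hinner : ∀ b : Fin D → ℕ, ∑ b' ∈ box D n, Real.exp (-(θ₀ / 2) * l1 (((n : ℤ) • y₂ + toSite b') - ((n : ℤ) • y₁ + toSite b)))
      ≤ Zl D (θ₀ / 2) := by
    intro b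
    set c : Fin D → ℤ := (n : ℤ) • y₁ + toSite b with hc
    have hinj : Set.InjOn (fun b' : Fin D → ℕ => (n : ℤ) • y₂ + toSite b') (box D n : Set (Fin D → ℕ)) := by
      intro b₁ _ b₂ _ h
      have h' : toSite b₁ = toSite b₂ := add_left_cancel h
      funext i
      have := congrFun h' i
      simp only [AffineAveraging.toSite] at this
      exact_mod_cast this
    rw [← Finset.sum_image (f := fun w : Fin D → ℤ => Real.exp (-(θ₀ / 2) * l1 (w - c))) hinj, ← tsum_exp_shift' (c := θ₀ / 2) c]
    exact (summable_exp_shift' hθ2 c).sum_le_tsum _ fun w _ => (Real.exp_pos _).le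
  -- assemble
  have hcard : ((box D n).card : ℝ) = (n : ℝ) ^ D := by
    have h : (box D n).card = n ^ D := by simp [AffineAveraging.box, Fintype.card_piFinset]
    rw [h]; push_cast; ring
  calc ∑ b ∈ box D n, ∑ b' ∈ box D n, m ((n : ℤ) • y₁ + toSite b) ((n : ℤ) • y₂ + toSite b')
      ≤ ∑ b ∈ box D n, ∑ b' ∈ box D n,
          (mB * E) * Real.exp (-(θ₀ / 2) * l1 (((n : ℤ) • y₂ + toSite b') - ((n : ℤ) • y₁ + toSite b))) :=
        Finset.sum_le_sum fun b hb => Finset.sum_le_sum fun b' hb' => hpt b hb b' hb'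
    _ = ∑ b ∈ box D n, (mB * E) * ∑ b' ∈ box D n, Real.exp (-(θ₀ / 2) * l1 (((n : ℤ) • y₂ + toSite b') - ((n : ℤ) • y₁ + toSite b))) := by
        refine Finset.sum_congr rfl fun b _ => ?_; rw [Finset.mul_sum]
    _ ≤ ∑ _b ∈ box D n, (mB * E) * Zl D (θ₀ / 2) :=
        Finset.sum_le_sum fun b _ => mul_le_mul_of_nonneg_left (hinner b) (by positivity)
    _ = (n : ℝ) ^ D * (Zl D (θ₀ / 2) * mB) * E := by
        rw [Finset.sum_const, nsmul_eq_mul, hcard]; ring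

end Local

/-! ## §2 `d = 3`: the block-pair totals of a scaled Wilson pair table (d1-leaf-01's per-slot-pair letter BY NAME) -/

section Wilson

/-- [our object] `blk` is linear in the kernel (entrywise `rfl`). -/
theorem blk_smul_apply (c : ℝ) (K : MKer 4 (Fib 3)) (j i : Bool) (x y : Site 4) (g f : Fin (3 + 1)) :
    blk (c • K) j i x y g f = c * blk K j i x y g f := rfl

/-- [folklore] **PER-SLOT-PAIR SUMMABILITY AND MASS OF A SCALED WILSON PAIR TABLE**: for every `c : ℝ`, the `(j, i)` block of `c • wilsonW₂ 3 T κ u κ′ u′` has summable plain mass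
`≤ (|c|·16·(wBound₂ 3 T·e⁸)·Zl 4 (1∕2)²)·e^{−1·|u′ − u|₁}` (d1-leaf-01 `plainMass_blk_wilsonW₂_le`, `tsum_mul_left`). -/
theorem plainMass_blk_smul_wilsonW₂_le (c : ℝ) (T : Fin 4 → Fin 4 → Fin 4 → Fin 4 → ℝ) (κ : Fin 4) (u : Fin 4 → ℤ) (κ' : Fin 4) (u' : Fin 4 → ℤ)
    (j i : Bool) :
    (Summable fun q : Site 4 × Site 4 => ∑ g, ∑ f, |blk (c • wilsonW₂ 3 T κ u κ' u') j i q.1 q.2 g f|) ∧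
      ∑' q : Site 4 × Site 4, ∑ g, ∑ f, |blk (c • wilsonW₂ 3 T κ u κ' u') j i q.1 q.2 g f|
        ≤ (|c| * (16 * (wBound₂ 3 T * Real.exp (8 * 1)) * Zl 4 (1 / 2) ^ 2)) * Real.exp (-1 * l1 (u' - u)) := by
  obtain ⟨hs, hb⟩ := plainMass_blk_wilsonW₂_le T κ u κ' u' j i
  have e : (fun q : Site 4 × Site 4 => ∑ g, ∑ f, |blk (c • wilsonW₂ 3 T κ u κ' u') j i q.1 q.2 g f|)
      = fun q => |c| * ∑ g, ∑ f, |blk (wilsonW₂ 3 T κ u κ' u') j i q.1 q.2 g f| := by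
    funext q
    rw [Finset.mul_sum]; refine Finset.sum_congr rfl fun g _ => ?_
    rw [Finset.mul_sum]; refine Finset.sum_congr rfl fun f _ => ?_
    rw [blk_smul_apply, abs_mul]
  rw [e]
  refine ⟨hs.mul_left _, ?_⟩
  rw [tsum_mul_left]
  calc |c| * ∑' q : Site 4 × Site 4, ∑ g, ∑ f, |blk (wilsonW₂ 3 T κ u κ' u') j i q.1 q.2 g f|
      ≤ |c| * (16 * (wBound₂ 3 T * Real.exp (8 * 1) * Real.exp (-1 * l1 (u' - u))) * Zl 4 (1 / 2) ^ 2) :=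
        mul_le_mul_of_nonneg_left hb (abs_nonneg c)
    _ = _ := by ring

/-- [folklore] **THE BLOCK-PAIR TOTALS OF A SCALED WILSON PAIR TABLE — POWER `n⁴`**: for every `c : ℝ`, every block side `n`, directions `κ κ′`, coarse blocks `y₁ y₂` and block `(j, i)`,
`Σ_{b,b′ ∈ box 4 n} Σ'|blk (c • wilsonW₂ 3 T κ (n•y₁+b) κ′ (n•y₂+b′)) j i| ≤ n⁴·(Zl 4 (1∕2)·(|c|·16·(wBound₂ 3 T·e⁸)·Zl 4 (1∕2)²))·e^{−(1∕2)|y₂ − y₁|₁}` — §1 at the n-free rate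
`θ₀ = 1` of `plainMass_blk_wilsonW₂_le`. -/
theorem blockPairTotal_smul_wilsonW₂_le (c : ℝ) (T : Fin 4 → Fin 4 → Fin 4 → Fin 4 → ℝ) (n : ℕ) (κ κ' : Fin 4) (y₁ y₂ : Site 4) (j i : Bool) :
    ∑ b ∈ box 4 n, ∑ b' ∈ box 4 n,
      (∑' q : Site 4 × Site 4, ∑ g, ∑ f, |blk (c • wilsonW₂ 3 T κ ((n : ℤ) • y₁ + toSite b) κ' ((n : ℤ) • y₂ + toSite b')) j i q.1 q.2 g f|)
      ≤ (n : ℝ) ^ 4 * (Zl 4 (1 / 2) * (|c| * (16 * (wBound₂ 3 T * Real.exp (8 * 1)) * Zl 4 (1 / 2) ^ 2)))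
          * Real.exp (-(1 / 2) * l1 (y₂ - y₁)) := by
  have h := blockPairTotal_le_of_local (D := 4) (n := n)
    (m := fun u u' => ∑' q : Site 4 × Site 4, ∑ g, ∑ f, |blk (c • wilsonW₂ 3 T κ u κ' u') j i q.1 q.2 g f|)
    (mB := |c| * (16 * (wBound₂ 3 T * Real.exp (8 * 1)) * Zl 4 (1 / 2) ^ 2)) (θ₀ := 1) one_pos
    (fun u u' => tsum_nonneg fun q => Finset.sum_nonneg fun g _ => Finset.sum_nonneg fun f _ => abs_nonneg _)
    (fun u u' => by simpa only [neg_mul, one_mul] using (plainMass_blk_smul_wilsonW₂_le c T κ u κ' u' j i).2) y₁ y₂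
  simpa only [one_div] using h

end Wilson

/-! ## §3 R-T's pair letter for the pure-Wilson straight-pin family — POWER 2, HYPOTHESIS-FREE — and the two-sector form -/

section RT

/-- [folklore] **THE PURE-WILSON STRAIGHT-PIN PAIR LETTER WITH POWER 2, HYPOTHESIS-FREE**: for `𝒲 n := vertex2OfK (KInvStep 3 n 0) n (((n:ℝ)^8·c₀) • wilsonW₂ 3 T)` (the Wilson
sector of the literal's level pair table with its `cE²`-type unit `n⁸` displayed, packed with two STRAIGHT one-shot columns), every scale `n = m + 1` and every coarse `z`:
`Summable` ∧ `Σ'_q Σ_{g f} |ffW (𝒲 (m+1)) μ 0 ν z q g f| ≤ ((m+1):ℝ)^2·(C_{K₀,2}(1∕2)·(|c₀|·C_W(T)))·e^{−(min (κ′∕8) (1∕4))·|z|₁}` — FILE B §5 `ffW_vertex2OfK_K₀_rows_pow` at `p = 2`,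
`θ = 1∕2`, the count `T = n^{12}·(|c₀|·C_W(T))` by §2 (`n⁴` slots-in-range × the literal's `n⁸`): the shape of R-T's `hWs ∕ hWm` with k-free `mW`, `κ`.  UNIT-PAGE-g23 §1's
«`W_tt ≍ n²·m̄W`» for the Wilson sector AS A THEOREM at the chart of record's pin. -/
theorem ffW_vertex2OfK_K₀_wilson_rows (T : Fin 4 → Fin 4 → Fin 4 → Fin 4 → ℝ) (c₀ : ℝ) (μ ν : Fin 4) (m : ℕ) (z : Site 4) :
    (Summable fun q : Site 4 × Site 4 => ∑ g, ∑ f,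
        |ffW (vertex2OfK (KInvStep (d := 3) (m + 1) 0) (m + 1)
          (fun κ u κ' u' => ((((m + 1 : ℕ) : ℝ)) ^ 8 * c₀) • wilsonW₂ 3 T κ u κ' u')) μ 0 ν z q.1 q.2 g f|) ∧
      ∑' q : Site 4 × Site 4, ∑ g, ∑ f,
          |ffW (vertex2OfK (KInvStep (d := 3) (m + 1) 0) (m + 1)
            (fun κ u κ' u' => ((((m + 1 : ℕ) : ℝ)) ^ 8 * c₀) • wilsonW₂ 3 T κ u κ' u')) μ 0 ν z q.1 q.2 g f|
        ≤ ((m + 1 : ℕ) : ℝ) ^ 2 * ((16 * ((MG163 4 * periodConst (kappa163 4) 3) * Real.exp (kappa163 4 / 4)) ^ 2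
            * (Real.exp (kappa163 4 / 4) * Real.exp (kappa163 4 / 4)) * (Zl 4 (kappa163 4 / 4 / 8) * Zl 4 ((1 / 2) / 2)))
            * (|c₀| * (Zl 4 (1 / 2) * (16 * (wBound₂ 3 T * Real.exp (8 * 1)) * Zl 4 (1 / 2) ^ 2))))
          * Real.exp (-(min (kappa163 4 / 4 / 8) ((1 / 2) / 2)) * l1 z) := by
  refine ffW_vertex2OfK_K₀_rows_pow 2 (S₂ := fun n κ u κ' u' => (((n : ℝ)) ^ 8 * c₀) • wilsonW₂ 3 T κ u κ' u') (θ := 1 / 2)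
    (mW := |c₀| * (Zl 4 (1 / 2) * (16 * (wBound₂ 3 T * Real.exp (8 * 1)) * Zl 4 (1 / 2) ^ 2))) (by norm_num)
    (fun m κ u κ' u' => (plainMass_blk_smul_wilsonW₂_le _ T κ u κ' u' true true).1) (fun m κ κ' y₁ y₂ => ?_) μ ν m z
  have h := blockPairTotal_smul_wilsonW₂_le ((((m + 1 : ℕ) : ℝ)) ^ 8 * c₀) T (m + 1) κ κ' y₁ y₂ true true
  refine h.trans (le_of_eq ?_)
  have hn0 : (0 : ℝ) ≤ ((m + 1 : ℕ) : ℝ) := by positivity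
  rw [abs_mul, abs_of_nonneg (pow_nonneg hn0 8)]
  ring

/-- [folklore] The same with the bare unit `n⁸` (no extra constant: `c₀ = 1`) — the spelling of d1-leaf-03's TT8 `S₂⁰`'s Wilson sector `n⁸ • wilsonW₂ 3 ((8N²)⁻¹ • wsym22 N)`
(the table's own `(8N²)⁻¹` sits inside `T`). -/
theorem ffW_vertex2OfK_K₀_wilson_rows_unit (T : Fin 4 → Fin 4 → Fin 4 → Fin 4 → ℝ) (μ ν : Fin 4) (m : ℕ) (z : Site 4) :
    (Summable fun q : Site 4 × Site 4 => ∑ g, ∑ f,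
        |ffW (vertex2OfK (KInvStep (d := 3) (m + 1) 0) (m + 1)
          (fun κ u κ' u' => ((((m + 1 : ℕ) : ℝ)) ^ 8) • wilsonW₂ 3 T κ u κ' u')) μ 0 ν z q.1 q.2 g f|) ∧
      ∑' q : Site 4 × Site 4, ∑ g, ∑ f,
          |ffW (vertex2OfK (KInvStep (d := 3) (m + 1) 0) (m + 1)
            (fun κ u κ' u' => ((((m + 1 : ℕ) : ℝ)) ^ 8) • wilsonW₂ 3 T κ u κ' u')) μ 0 ν z q.1 q.2 g f|
        ≤ ((m + 1 : ℕ) : ℝ) ^ 2 * ((16 * ((MG163 4 * periodConst (kappa163 4) 3) * Real.exp (kappa163 4 / 4)) ^ 2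
            * (Real.exp (kappa163 4 / 4) * Real.exp (kappa163 4 / 4)) * (Zl 4 (kappa163 4 / 4 / 8) * Zl 4 ((1 / 2) / 2)))
            * (Zl 4 (1 / 2) * (16 * (wBound₂ 3 T * Real.exp (8 * 1)) * Zl 4 (1 / 2) ^ 2)))
          * Real.exp (-(min (kappa163 4 / 4 / 8) ((1 / 2) / 2)) * l1 z) := by
  have h := ffW_vertex2OfK_K₀_wilson_rows T 1 μ ν m z
  simpa only [mul_one, abs_one, one_mul] using h

/-- [our object] `blk` is additive in the kernel (entrywise `rfl`). -/
theorem blk_add_apply (A B : MKer 4 (Fib 3)) (j i : Bool) (x y : Site 4) (g f : Fin (3 + 1)) :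
    blk (A + B) j i x y g f = blk A j i x y g f + blk B j i x y g f := rfl

/-- [folklore] **THE TWO-SECTOR FORM**: for `S₂ n := (((n:ℝ)^8·c₀) • wilsonW₂ 3 T) + V₂ n` with the OTHER sector's tt blocks per-slot-pair summable and its tt block-pair totals
DISPLAYED `≤ n^{12}·m̄V·e^{−(1∕2)|y₂ − y₁|₁}` at every scale `n = m + 1` (the table author's count — for the literal's border sector `cB • tabs.vh₂S` an1's, NOT supplied here),
the family `𝒲 n := vertex2OfK (KInvStep 3 n 0) n (S₂ n)` obeys R-T's pair letter with POWER 2 and `mW := C_{K₀,2}(1∕2)·(|c₀|·C_W(T) + m̄V)` (subadditivity of block-pair totals). -/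
theorem ffW_vertex2OfK_K₀_wilson_add_rows (T : Fin 4 → Fin 4 → Fin 4 → Fin 4 → ℝ) (c₀ : ℝ)
    {V₂ : ℕ → Fin 4 → Site 4 → Fin 4 → Site 4 → MKer 4 (Fib 3)} {mV : ℝ}
    (hVs : ∀ (m : ℕ) κ u κ' u', Summable fun q : Site 4 × Site 4 => ∑ g, ∑ f, |blk (V₂ (m + 1) κ u κ' u') true true q.1 q.2 g f|)
    (hVB : ∀ (m : ℕ) (κ κ' : Fin 4) (y₁ y₂ : Site 4), ∑ b ∈ box 4 (m + 1), ∑ b' ∈ box 4 (m + 1),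
      (∑' q : Site 4 × Site 4, ∑ g, ∑ f,
        |blk (V₂ (m + 1) κ (((m + 1 : ℕ) : ℤ) • y₁ + toSite b) κ' (((m + 1 : ℕ) : ℤ) • y₂ + toSite b')) true true q.1 q.2 g f|)
        ≤ ((m + 1 : ℕ) : ℝ) ^ 12 * mV * Real.exp (-(1 / 2) * l1 (y₂ - y₁)))
    (μ ν : Fin 4) (m : ℕ) (z : Site 4) :
    (Summable fun q : Site 4 × Site 4 => ∑ g, ∑ f,
        |ffW (vertex2OfK (KInvStep (d := 3) (m + 1) 0) (m + 1)
          (fun κ u κ' u' => ((((m + 1 : ℕ) : ℝ)) ^ 8 * c₀) • wilsonW₂ 3 T κ u κ' u' + V₂ (m + 1) κ u κ' u')) μ 0 ν z q.1 q.2 g f|) ∧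
      ∑' q : Site 4 × Site 4, ∑ g, ∑ f,
          |ffW (vertex2OfK (KInvStep (d := 3) (m + 1) 0) (m + 1)
            (fun κ u κ' u' => ((((m + 1 : ℕ) : ℝ)) ^ 8 * c₀) • wilsonW₂ 3 T κ u κ' u' + V₂ (m + 1) κ u κ' u')) μ 0 ν z q.1 q.2 g f|
        ≤ ((m + 1 : ℕ) : ℝ) ^ 2 * ((16 * ((MG163 4 * periodConst (kappa163 4) 3) * Real.exp (kappa163 4 / 4)) ^ 2
            * (Real.exp (kappa163 4 / 4) * Real.exp (kappa163 4 / 4)) * (Zl 4 (kappa163 4 / 4 / 8) * Zl 4 ((1 / 2) / 2)))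
            * (|c₀| * (Zl 4 (1 / 2) * (16 * (wBound₂ 3 T * Real.exp (8 * 1)) * Zl 4 (1 / 2) ^ 2)) + mV))
          * Real.exp (-(min (kappa163 4 / 4 / 8) ((1 / 2) / 2)) * l1 z) := by
  -- per slot pair: the sum's tt block is dominated termwise by the two sectors'
  have hdom : ∀ (n : ℕ) (κ : Fin 4) (u : Site 4) (κ' : Fin 4) (u' : Site 4) (q : Site 4 × Site 4),
      (∑ g, ∑ f, |blk ((((n : ℝ)) ^ 8 * c₀) • wilsonW₂ 3 T κ u κ' u' + V₂ n κ u κ' u') true true q.1 q.2 g f|)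
        ≤ (∑ g, ∑ f, |blk ((((n : ℝ)) ^ 8 * c₀) • wilsonW₂ 3 T κ u κ' u') true true q.1 q.2 g f|)
          + ∑ g, ∑ f, |blk (V₂ n κ u κ' u') true true q.1 q.2 g f| := by
    intro n κ u κ' u' q
    rw [← Finset.sum_add_distrib]; refine Finset.sum_le_sum fun g _ => ?_
    rw [← Finset.sum_add_distrib]; refine Finset.sum_le_sum fun f _ => ?_
    rw [blk_add_apply]; exact abs_add_le _ _
  have hnn : ∀ (n : ℕ) (κ : Fin 4) (u : Site 4) (κ' : Fin 4) (u' : Site 4) (q : Site 4 × Site 4),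
      0 ≤ ∑ g, ∑ f, |blk ((((n : ℝ)) ^ 8 * c₀) • wilsonW₂ 3 T κ u κ' u' + V₂ n κ u κ' u') true true q.1 q.2 g f| :=
    fun n κ u κ' u' q => Finset.sum_nonneg fun g _ => Finset.sum_nonneg fun f _ => abs_nonneg _
  have hsum : ∀ (m : ℕ) (κ : Fin 4) (u : Site 4) (κ' : Fin 4) (u' : Site 4),
      (Summable fun q : Site 4 × Site 4 =>
        ∑ g, ∑ f, |blk ((((((m + 1 : ℕ) : ℝ))) ^ 8 * c₀) • wilsonW₂ 3 T κ u κ' u' + V₂ (m + 1) κ u κ' u') true true q.1 q.2 g f|) ∧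
      ∑' q : Site 4 × Site 4, ∑ g, ∑ f, |blk ((((((m + 1 : ℕ) : ℝ))) ^ 8 * c₀) • wilsonW₂ 3 T κ u κ' u' + V₂ (m + 1) κ u κ' u') true true q.1 q.2 g f|
        ≤ (∑' q : Site 4 × Site 4, ∑ g, ∑ f, |blk ((((((m + 1 : ℕ) : ℝ))) ^ 8 * c₀) • wilsonW₂ 3 T κ u κ' u') true true q.1 q.2 g f|)
          + ∑' q : Site 4 × Site 4, ∑ g, ∑ f, |blk (V₂ (m + 1) κ u κ' u') true true q.1 q.2 g f| := by
    intro m κ u κ' u'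
    have hW := (plainMass_blk_smul_wilsonW₂_le ((((m + 1 : ℕ) : ℝ)) ^ 8 * c₀) T κ u κ' u' true true).1
    have hV := hVs m κ u κ' u'
    have hs : Summable fun q : Site 4 × Site 4 =>
        ∑ g, ∑ f, |blk ((((((m + 1 : ℕ) : ℝ))) ^ 8 * c₀) • wilsonW₂ 3 T κ u κ' u' + V₂ (m + 1) κ u κ' u') true true q.1 q.2 g f| :=
      Summable.of_nonneg_of_le (hnn (m + 1) κ u κ' u') (hdom (m + 1) κ u κ' u') (hW.add hV)
    refine ⟨hs, ?_⟩
    rw [← hW.tsum_add hV]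
    exact Summable.tsum_le_tsum (hdom (m + 1) κ u κ' u') hs (hW.add hV)
  refine ffW_vertex2OfK_K₀_rows_pow 2
    (S₂ := fun n κ u κ' u' => (((n : ℝ)) ^ 8 * c₀) • wilsonW₂ 3 T κ u κ' u' + V₂ n κ u κ' u') (θ := 1 / 2)
    (mW := |c₀| * (Zl 4 (1 / 2) * (16 * (wBound₂ 3 T * Real.exp (8 * 1)) * Zl 4 (1 / 2) ^ 2)) + mV) (by norm_num)
    (fun m κ u κ' u' => (hsum m κ u κ' u').1) (fun m κ κ' y₁ y₂ => ?_) μ ν m z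
  -- block-pair totals: subadditivity, then §2 for the Wilson sector and the displayed letter for the other
  have hW := blockPairTotal_smul_wilsonW₂_le ((((m + 1 : ℕ) : ℝ)) ^ 8 * c₀) T (m + 1) κ κ' y₁ y₂ true true
  have hV := hVB m κ κ' y₁ y₂
  have hn0 : (0 : ℝ) ≤ ((m + 1 : ℕ) : ℝ) := by positivity
  rw [abs_mul, abs_of_nonneg (pow_nonneg hn0 8)] at hW
  calc ∑ b ∈ box 4 (m + 1), ∑ b' ∈ box 4 (m + 1), ∑' q : Site 4 × Site 4, ∑ g, ∑ f,
        |blk ((((((m + 1 : ℕ) : ℝ))) ^ 8 * c₀) • wilsonW₂ 3 T κ (((m + 1 : ℕ) : ℤ) • y₁ + toSite b) κ' (((m + 1 : ℕ) : ℤ) • y₂ + toSite b')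
          + V₂ (m + 1) κ (((m + 1 : ℕ) : ℤ) • y₁ + toSite b) κ' (((m + 1 : ℕ) : ℤ) • y₂ + toSite b')) true true q.1 q.2 g f|
      ≤ ∑ b ∈ box 4 (m + 1), ∑ b' ∈ box 4 (m + 1),
          ((∑' q : Site 4 × Site 4, ∑ g, ∑ f,
            |blk ((((((m + 1 : ℕ) : ℝ))) ^ 8 * c₀) • wilsonW₂ 3 T κ (((m + 1 : ℕ) : ℤ) • y₁ + toSite b) κ' (((m + 1 : ℕ) : ℤ) • y₂ + toSite b'))
              true true q.1 q.2 g f|)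
          + ∑' q : Site 4 × Site 4, ∑ g, ∑ f,
            |blk (V₂ (m + 1) κ (((m + 1 : ℕ) : ℤ) • y₁ + toSite b) κ' (((m + 1 : ℕ) : ℤ) • y₂ + toSite b')) true true q.1 q.2 g f|) :=
        Finset.sum_le_sum fun b _ => Finset.sum_le_sum fun b' _ => (hsum m κ _ κ' _).2
    _ = (∑ b ∈ box 4 (m + 1), ∑ b' ∈ box 4 (m + 1), ∑' q : Site 4 × Site 4, ∑ g, ∑ f,
            |blk ((((((m + 1 : ℕ) : ℝ))) ^ 8 * c₀) • wilsonW₂ 3 T κ (((m + 1 : ℕ) : ℤ) • y₁ + toSite b) κ' (((m + 1 : ℕ) : ℤ) • y₂ + toSite b'))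
              true true q.1 q.2 g f|)
        + ∑ b ∈ box 4 (m + 1), ∑ b' ∈ box 4 (m + 1), ∑' q : Site 4 × Site 4, ∑ g, ∑ f,
            |blk (V₂ (m + 1) κ (((m + 1 : ℕ) : ℤ) • y₁ + toSite b) κ' (((m + 1 : ℕ) : ℤ) • y₂ + toSite b')) true true q.1 q.2 g f| := by
        rw [← Finset.sum_add_distrib]; refine Finset.sum_congr rfl fun b _ => ?_; rw [Finset.sum_add_distrib]
    _ ≤ ((m + 1 : ℕ) : ℝ) ^ 4 * (Zl 4 (1 / 2) * ((((m + 1 : ℕ) : ℝ)) ^ 8 * |c₀| * (16 * (wBound₂ 3 T * Real.exp (8 * 1)) * Zl 4 (1 / 2) ^ 2)))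
          * Real.exp (-(1 / 2) * l1 (y₂ - y₁))
        + ((m + 1 : ℕ) : ℝ) ^ 12 * mV * Real.exp (-(1 / 2) * l1 (y₂ - y₁)) := add_le_add hW hV
    _ = ((m + 1 : ℕ) : ℝ) ^ (2 + 10) * (|c₀| * (Zl 4 (1 / 2) * (16 * (wBound₂ 3 T * Real.exp (8 * 1)) * Zl 4 (1 / 2) ^ 2)) + mV)
          * Real.exp (-(1 / 2) * l1 (y₂ - y₁)) := by ring

end RT

end Summit.QuantumFields.BalabanUV.Beta.D1BFx.PackedStraightColumnWilsonPair

end
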